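import Mathlib
import HarnessLib
import Summits.HubbardSuperconductivity.HubbardSuperconductivity.Theorems.KLProgrammeKLRegimeTwoVolumeLipBornDiffKit
import Summits.HubbardSuperconductivity.HubbardSuperconductivity.Theorems.KLProgrammeKLRegimeTwoVolumeLipKitUnits

/-!
# Route `KLProgramme` — crux K3 ENGINE (stmt-HubbardSuperconductivity-20437), stub (e) proof-input «(e)-D-ROWS», (M7): THE (Db) ROW IN THE KIT'S DIMENSIONLESS FORM,
# ANY UNITS `(u, Kc)` — the two-volume twin of `…EngineTowerBlockIncrWtKitUnits.klTowerBornWtAt_le_kit_units`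
# (seat hubbard-kl-k3c4-p1 g24; `--supports` 20437; DROWS-SCOPE-g24 v8 §10.3 (A))

`…TwoVolumeLipBornDiffKit.klLipBornDiff_pinned_le_kit` bounds the born difference of block `k` at a deep pin by the KIT image of the LIP door (absolute profiles
`NV`, `ND`, `E`) plus SRC.  For any unit pair `(u, Kc)` (E1's `u = 8^J`, `Kc = 2^{−5J}` at the block's boundary `J = dk−1`; here free positive reals) write the three
profiles in units, `NV m = Kc·u^m·bV m`, `ND m = Kc·u^m·bD m`, `E m = Kc·u^m·bE m` (so the hypotheses read `klLipInputDiffSup … (2m) R ≤ Kc·u^m·bE m` etc.); then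
`…TwoVolumeLipKitUnits.lipKit_abs_eq_units` rewrites the kit image as `cW^{2q−1}(u^q Kc)(cW·Ŝ₂(bE; bV+bD+bE) + cWΛ⁻¹·Ŝ_{2Λ}(bD; bV+bD) + τ·Ŝ₂(bD; bV+bD))` with the
rescaled constants `(σ̂, τ̂, Φ̂, ψ̂) = (κ²u, (e²(κ+ρ))²u, (eα/κ²)·Kc, ρ⁻²/u)` — the first bracket is LITERALLY the right side of the Lipschitz step of
`EngineV8.towerBornDiff_le_law_of_profile_tok` (first order `towerFO D σ̂ bE q`, telescoped orders `towerSLip D τ̂ bE (bV+bD+bE)`, `Ct = 2` tail) for the dimensionless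
born-difference array `klLipBornDiff…/(cW^{2q}·u^q·Kc)`, the other two brackets and SRC go to its source slot.  The kit guards are stated in the dimensionless form
`Φ̂·towerV D τ̂ (bV+bD+bE) < 1`, `Φ̂·towerV D τ̂ (bV+bD) < 1`.

* **`klLipBornDiff_pinned_le_kit_units`** — the displayed bound (pin level; the sup form follows by `…LipDiffSups.klLipBornDiffSup_le_of_forall`).

A composition of landed theorems; nothing asserts the (D) rows, stub (e), VL, K3 or superconductivity.
References: BGM 2006 §2.8 (2.83), §3 (3.2)–(3.8) [cite: BenfattoGiulianiMastropietro2006]; Gawȩdzki–Kupiainen 1985 §3.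
-/

noncomputable section

namespace Summit.HubbardSuperconductivity.HubbardSuperconductivity.Theorems.TwoVolumeLip

set_option linter.dupNamespace false -- summit = problem name (single-conjunct summit), D-0017

open Finset Literature.MathematicalPhysics.QuantumLattice GrassmannAlgebra Literature.Probability.LatticeModels
  Literature.Probability.LatticeModels.BattleFederbush
open Literature.MathematicalPhysics.QuantumLattice.FermiRG
open Summit.HubbardSuperconductivity.HubbardSuperconductivity.Theorems.KLRegimeSplit
open Summit.HubbardSuperconductivity.HubbardSuperconductivity.Theorems.KLProgrammeLegKernels
open Summit.HubbardSuperconductivity.HubbardSuperconductivity.Theorems.DispersionFlow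
open Summit.HubbardSuperconductivity.HubbardSuperconductivity.Theorems.EngineV8
open Summit.HubbardSuperconductivity.HubbardSuperconductivity.Theorems.TwoVolumeSource
open Summit.HubbardSuperconductivity.HubbardSuperconductivity.Theorems.TwoVolumeDefect

variable {L b M : ℕ} [NeZero L] [NeZero (b * L)] [NeZero M]

set_option maxHeartbeats 400000 in -- the kit row and the units identity in one declaration
/-- **The (Db) row in the kit's dimensionless form, any units `(u, Kc)`** (see the module docstring). -/
theorem klLipBornDiff_pinned_le_kit_units {β : ℝ} (hβ : 0 < β) (U μ : ℝ) (K : TrigPolyC4v) {d k : ℕ} (hdk : 1 ≤ d * k)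
    (hZf : hubbardEffPartitionFnCT (b * L) M β U μ 0 K (klScale klE0 (d * k)) ≠ 0)
    (hZc : hubbardEffPartitionFnCT L M β U μ 0 K (klScale klE0 (d * k)) ≠ 0)
    {κ : ℝ} (hκ : 0 < κ) (hGB : IsGramBoundedR ((sectorSubMatrix (b * L) M β (bgmFatMultiplier (b * L) M klE0 β (nambuXiCT (b * L) μ K) (d * k - 1))).transpose * hubbardCovSliceCT (b * L) M β μ 0 K (klScale klE0 (d * (k + 1))) (klScale klE0 (d * k)) * sectorSubMatrix (b * L) M β (bgmFatMultiplier (b * L) M klE0 β (nambuXiCT (b * L) μ K) (d * k - 1))) κ)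
    {u Kc : ℝ} (hu : 0 < u) (hKc : 0 < Kc) (bV bD : ℕ → ℝ) (hbV0 : ∀ m', 0 ≤ bV m') (hbD0 : ∀ m', 0 ≤ bD m')
    (hNV : ∀ m' (j : Fin (2 * m')) (x : (SpaceTimeIdx (b * L) M × SectorLeg (sectorCount (d * k - 1)))), ∑ Y ∈ univ.filter (fun Y : Fin (2 * m') → (SpaceTimeIdx (b * L) M × SectorLeg (sectorCount (d * k - 1))) => Y j = x),
      ‖kernel ℂ (klGlue L b M (sectorCount (d * k - 1)) (klLipInput L M β U μ K d k)) (2 * m') Y‖ * klGluedWt L b M β (d * k - 1) (sectorCount (d * k - 1)) (univ.image Y) ≤ Kc * (u ^ m' * bV m'))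
    (hND : ∀ m' (j : Fin (2 * m')) (x : (SpaceTimeIdx (b * L) M × SectorLeg (sectorCount (d * k - 1)))), ∑ Y ∈ univ.filter (fun Y : Fin (2 * m') → (SpaceTimeIdx (b * L) M × SectorLeg (sectorCount (d * k - 1))) => Y j = x),
      ‖kernel ℂ (klLipInputDiff L b M β U μ K d k) (2 * m') Y‖ * klGluedWt L b M β (d * k - 1) (sectorCount (d * k - 1)) (univ.image Y) ≤ Kc * (u ^ m' * bD m'))
    (R R' : ℕ) (bE : ℕ → ℝ) (hbE0 : ∀ m', 0 ≤ bE m') (hE : ∀ m', klLipInputDiffSup L b M β U μ K d k (2 * m') R ≤ Kc * (u ^ m' * bE m'))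
    (hbV00 : bV 0 = 0) (hbD00 : bD 0 = 0) (hbE00 : bE 0 = 0)
    {α : ℝ} (hα : 0 < α)
    (hrow : ∀ X, ∑ Y, ‖((sectorSubMatrix (b * L) M β (bgmFatMultiplier (b * L) M klE0 β (nambuXiCT (b * L) μ K) (d * k - 1))).transpose * hubbardCovSliceCT (b * L) M β μ 0 K (klScale klE0 (d * (k + 1))) (klScale klE0 (d * k)) * sectorSubMatrix (b * L) M β (bgmFatMultiplier (b * L) M klE0 β (nambuXiCT (b * L) μ K) (d * k - 1))) X Y‖ * klGluedWt L b M β (d * k - 1) (sectorCount (d * k - 1)) {X, Y} ≤ α)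
    (hcol : ∀ Y, ∑ X, ‖((sectorSubMatrix (b * L) M β (bgmFatMultiplier (b * L) M klE0 β (nambuXiCT (b * L) μ K) (d * k - 1))).transpose * hubbardCovSliceCT (b * L) M β μ 0 K (klScale klE0 (d * (k + 1))) (klScale klE0 (d * k)) * sectorSubMatrix (b * L) M β (bgmFatMultiplier (b * L) M klE0 β (nambuXiCT (b * L) μ K) (d * k - 1))) X Y‖ * klGluedWt L b M β (d * k - 1) (sectorCount (d * k - 1)) {X, Y} ≤ α)
    {ρ : ℝ} (hρ : 0 < ρ)
    {D : ℕ} (hD : Fintype.card (SpaceTimeIdx (b * L) M × SectorLeg (sectorCount (d * k - 1))) / 2 ≤ D)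
    (hg₁ : Real.exp 1 * α / κ ^ 2 * Kc * towerV D ((Real.exp 2 * (κ + ρ)) ^ 2 * u) (fun m => bV m + bD m + bE m) < 1)
    (hg₂ : Real.exp 1 * α / κ ^ 2 * Kc * towerV D ((Real.exp 2 * (κ + ρ)) ^ 2 * u) (fun m => bV m + bD m) < 1)
    {N₀ : ℕ} (hN₀ : 2 ≤ N₀)
    {Λ : ℝ} (hΛ1 : 1 ≤ Λ) (hΛle : Λ ≤ 1 + klScale klE0 (d * k - 1) * ((R' : ℝ) + 1))
    (jr : ℕ) {ΛT cW : ℝ} (hΛT : 0 ≤ ΛT) (hΛr : ΛT ≤ klScale klE0 jr) (hcW : 0 ≤ cW)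
    (hrowT : ∀ x, ∑ y', ‖klLipTransfer (b * L) M β μ K d k x y'‖ *
      klScaleWt (b * L) M β jr {latticeLegPos (2 * (2 * M)) x, latticeLegPos (2 * (2 * M)) y'} ≤ cW)
    (hcolT : ∀ y', ∑ x, ‖klLipTransfer (b * L) M β μ K d k x y'‖ *
      klScaleWt (b * L) M β jr {latticeLegPos (2 * (2 * M)) x, latticeLegPos (2 * (2 * M)) y'} ≤ cW)
    (D₀ r : ℕ) (hD₀ : 2 * r ≤ D₀) (hRR' : R + R' ≤ D₀)
    {n q : ℕ} (hq : 2 * q = n + 1)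
    {N Nfar Es NDs : ℝ} (hN0 : 0 ≤ N) (hNfar0 : 0 ≤ Nfar) (hEs0 : 0 ≤ Es) (hNDs0 : 0 ≤ NDs)
    (hN : ∀ (p : Fin (n + 1)) y, ∑ Y ∈ univ.filter (fun Y : Fin (n + 1) → SpaceTimeIdx L M × SectorLeg (sectorCount (d * k - 1)) => Y p = y),
      ‖kernel ℂ (effAction ℂ (klLipCov L M β μ K d k) (klLipInput L M β U μ K d k) - klLipInput L M β U μ K d k) (n + 1) Y‖ ≤ N)
    (hNfar : ∀ (p : Fin (n + 1)) y (i : Fin (n + 1)),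
      ∑ Y ∈ univ.filter (fun Y : Fin (n + 1) → SpaceTimeIdx L M × SectorLeg (sectorCount (d * k - 1)) => Y p = y ∧ r < Torus.tnorm ((Y p).1.2 - (Y i).1.2)),
        ‖kernel ℂ (effAction ℂ (klLipCov L M β μ K d k) (klLipInput L M β U μ K d k) - klLipInput L M β U μ K d k) (n + 1) Y‖ ≤ Nfar)
    (hEs : ∀ (p : Fin (n + 1)) (y' : SpaceTimeIdx (b * L) M × SectorLeg (sectorCount (d * k - 1))), y' ∈ klDeepPins L D₀ →
      ∑ Y' ∈ univ.filter (fun Y' : Fin (n + 1) → SpaceTimeIdx (b * L) M × SectorLeg (sectorCount (d * k - 1)) => Y' p = y'),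
        ‖kernel ℂ ((effAction ℂ (klLipCov (b * L) M β μ K d k) (klGlue L b M (sectorCount (d * k - 1)) (klLipInput L M β U μ K d k)) -
              klGlue L b M (sectorCount (d * k - 1)) (klLipInput L M β U μ K d k)) -
            klGlue L b M (sectorCount (d * k - 1))
              (effAction ℂ (klLipCov L M β μ K d k) (klLipInput L M β U μ K d k) - klLipInput L M β U μ K d k)) (n + 1) Y'‖ ≤ Es)
    (hNDs : ∀ (p : Fin (n + 1)) (y' : SpaceTimeIdx (b * L) M × SectorLeg (sectorCount (d * k - 1))),
      ∑ Y' ∈ univ.filter (fun Y' : Fin (n + 1) → SpaceTimeIdx (b * L) M × SectorLeg (sectorCount (d * k - 1)) => Y' p = y'),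
        ‖kernel ℂ ((effAction ℂ (klLipCov (b * L) M β μ K d k) (klGlue L b M (sectorCount (d * k - 1)) (klLipInput L M β U μ K d k)) -
              klGlue L b M (sectorCount (d * k - 1)) (klLipInput L M β U μ K d k)) -
            klGlue L b M (sectorCount (d * k - 1))
              (effAction ℂ (klLipCov L M β μ K d k) (klLipInput L M β U μ K d k) - klLipInput L M β U μ K d k)) (n + 1) Y'‖ ≤ NDs)
    (p : Fin (n + 1)) (w'' : SpaceTimeIdx (b * L) M × SectorLeg (sectorCount (d * k))) (hw'' : w'' ∈ klDeepPins L (D₀ + r)) :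
    ∑ X'' ∈ univ.filter (fun X'' : Fin (n + 1) → SpaceTimeIdx (b * L) M × SectorLeg (sectorCount (d * k)) => X'' p = w''),
        ‖kernel ℂ (klLipBornDiff L b M β U μ K d k) (n + 1) X''‖ ≤
      cW ^ (2 * q - 1) * (u ^ q * Kc) *
        (cW * (towerFO D (κ ^ 2 * u) bE q +
            (∑ n' ∈ Icc 2 (N₀ - 1), Real.exp 1 * (Real.exp 1 * α / κ ^ 2 * Kc) ^ (n' - 1) * (ρ⁻¹ ^ 2 / u) ^ q * towerSLip D ((Real.exp 2 * (κ + ρ)) ^ 2 * u) bE (fun m => bV m + bD m + bE m) n' q) +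
            2 * ((ρ⁻¹ ^ 2 / u) ^ q * Real.exp 1 * towerV D ((Real.exp 2 * (κ + ρ)) ^ 2 * u) (fun m => bV m + bD m + bE m) *
              ((Real.exp 1 * α / κ ^ 2 * Kc) * towerV D ((Real.exp 2 * (κ + ρ)) ^ 2 * u) (fun m => bV m + bD m + bE m)) ^ (N₀ - 1) / (1 - (Real.exp 1 * α / κ ^ 2 * Kc) * towerV D ((Real.exp 2 * (κ + ρ)) ^ 2 * u) (fun m => bV m + bD m + bE m)))) +
          cW * Λ⁻¹ * (towerFO D (κ ^ 2 * u) bD q +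
            (∑ n' ∈ Icc 2 (N₀ - 1), Real.exp 1 * (Real.exp 1 * α / κ ^ 2 * Kc) ^ (n' - 1) * (ρ⁻¹ ^ 2 / u) ^ q * towerSLip D ((Real.exp 2 * (κ + ρ)) ^ 2 * u) bD (fun m => bV m + bD m) n' q) +
            (2 * Λ) * ((ρ⁻¹ ^ 2 / u) ^ q * Real.exp 1 * towerV D ((Real.exp 2 * (κ + ρ)) ^ 2 * u) (fun m => bV m + bD m) *
              ((Real.exp 1 * α / κ ^ 2 * Kc) * towerV D ((Real.exp 2 * (κ + ρ)) ^ 2 * u) (fun m => bV m + bD m)) ^ (N₀ - 1) / (1 - (Real.exp 1 * α / κ ^ 2 * Kc) * towerV D ((Real.exp 2 * (κ + ρ)) ^ 2 * u) (fun m => bV m + bD m)))) +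
          cW / (1 + ΛT * ((r : ℝ) + 1)) * (towerFO D (κ ^ 2 * u) bD q +
            (∑ n' ∈ Icc 2 (N₀ - 1), Real.exp 1 * (Real.exp 1 * α / κ ^ 2 * Kc) ^ (n' - 1) * (ρ⁻¹ ^ 2 / u) ^ q * towerSLip D ((Real.exp 2 * (κ + ρ)) ^ 2 * u) bD (fun m => bV m + bD m) n' q) +
            2 * ((ρ⁻¹ ^ 2 / u) ^ q * Real.exp 1 * towerV D ((Real.exp 2 * (κ + ρ)) ^ 2 * u) (fun m => bV m + bD m) *
              ((Real.exp 1 * α / κ ^ 2 * Kc) * towerV D ((Real.exp 2 * (κ + ρ)) ^ 2 * u) (fun m => bV m + bD m)) ^ (N₀ - 1) / (1 - (Real.exp 1 * α / κ ^ 2 * Kc) * towerV D ((Real.exp 2 * (κ + ρ)) ^ 2 * u) (fun m => bV m + bD m))))) +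
      (cW ^ n * (cW * Es + cW / (1 + ΛT * ((r : ℝ) + 1)) * NDs) +
        (2 * cW ^ n * (cW / (1 + ΛT * ((r : ℝ) + 1))) * N + n * cW ^ n * (5 * (cW / (1 + ΛT * ((r : ℝ) + 1))) * N + 2 * cW * Nfar))) := by
  have hμ₁ : (fun m' => Kc * (u ^ m' * bV m') + Kc * (u ^ m' * bD m') + Kc * (u ^ m' * bE m')) = fun m => Kc * (u ^ m * (bV m + bD m + bE m)) :=
    funext fun m => by ring
  have hμ₂ : (fun m' => Kc * (u ^ m' * bV m') + Kc * (u ^ m' * bD m')) = fun m => Kc * (u ^ m * (bV m + bD m)) := funext fun m => by ring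
  have hg₁' : Real.exp 1 * α / κ ^ 2 * towerV D ((Real.exp 2 * (κ + ρ)) ^ 2)
      (fun m' => Kc * (u ^ m' * bV m') + Kc * (u ^ m' * bD m') + Kc * (u ^ m' * bE m')) < 1 := by
    rw [hμ₁, towerV_units, ← mul_assoc]; exact hg₁
  have hg₂' : Real.exp 1 * α / κ ^ 2 * towerV D ((Real.exp 2 * (κ + ρ)) ^ 2) (fun m' => Kc * (u ^ m' * bV m') + Kc * (u ^ m' * bD m')) < 1 := by
    rw [hμ₂, towerV_units, ← mul_assoc]; exact hg₂
  have h := klLipBornDiff_pinned_le_kit hβ U μ K hdk hZf hZc hκ hGB (fun m => Kc * (u ^ m * bV m)) (fun m => Kc * (u ^ m * bD m))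
    (fun m' => mul_nonneg hKc.le (mul_nonneg (pow_nonneg hu.le _) (hbV0 m'))) (fun m' => mul_nonneg hKc.le (mul_nonneg (pow_nonneg hu.le _) (hbD0 m')))
    hNV hND R R' (fun m => Kc * (u ^ m * bE m)) (fun m' => mul_nonneg hKc.le (mul_nonneg (pow_nonneg hu.le _) (hbE0 m'))) hE
    (by simp only [hbV00, mul_zero]) (by simp only [hbD00, mul_zero]) (by simp only [hbE00, mul_zero]) hα hrow hcol hρ hD hg₁' hg₂' hN₀ hΛ1 hΛle
    jr hΛT hΛr hcW hrowT hcolT D₀ r hD₀ hRR' hq hN0 hNfar0 hEs0 hNDs0 hN hNfar hEs hNDs p w'' hw''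
  rw [lipKit_abs_eq_units hKc.ne' hu.ne'] at h
  exact h

end Summit.HubbardSuperconductivity.HubbardSuperconductivity.Theorems.TwoVolumeLip

end
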